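import Summits.CriticalPhenomena.PercolationContinuityZ3.Theorems.Transplant.FKConnectivityAllQAntipodalRootCertPair
import HarnessLib

/-!
# Connectivity correlation inequalities for `φ_{w,q}`, every `q > 0` — file 78c: **THE ROOT-SLICING IDENTITIES** (equality form) and the
# positivity of `f̂ĝ` on the four folded generators

Support file (`--supports stmt-CriticalPhenomena-4575`), FK sub-lane `prim-bschramm-fk-2` (gen 36); builds on p205010 (kernel theorem, internal audit
signed; external expert review pending).  No definitions, no named facts, no sorries; standard axioms.

Files 78a/78b (`…RootCert`, `…RootCertPair`) prove the INEQUALITY `Σ_{ℓ≤J} f̂ĝ ≤ 0` from a sliced certificate.  For structural arguments that bound the sliced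
pairing by other means (the one-sum / two-sum recursions of FK-Q2 §45) one needs the underlying EQUALITIES, which this file isolates:
* **`FK.levels_sum_eq_neg_rootSlice`** (one root `e ∈ S ⊆ M`): `Σ_{γ⊆M, ℓ(γ)≤J} Φ(γ) = −Σ_{δ⊆M∖e} (1{ℓ(τ_Sδ)≤J} − 1{ℓ(δ)≤J}) Φ(δ)`,
* **`FK.levels_sum_eq_neg_two_quarterSlice`** (two roots `e ∈ S`, `e' ∈ M∖S`): `Σ_{γ⊆M, ℓ(γ)≤J} Φ(γ) = −2 Σ_{δ⊆M∖{e,e'}} (1{ℓ(τ_Sδ)≤J} − 1{ℓ(δ)≤J}) Φ(δ)`,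
where `Φ = f̂ĝ`, `f` reads only `S`, `g` does not read `S` (no monotonicity needed for the identities), `ℓ = apExpC M C`, `τ_Sδ = (S∖δ)∪(δ∖S)`;
and the four generator inequalities for increasing `f, g` as standalone lemmas on the quarter `δ ⊆ M∖{e,e'}`: **`FK.symDownY_hat_nonneg`**,
**`FK.symDownX_hat_nonneg`**, **`FK.kleinOrbit_hat_nonneg`** (the elementary square is `FK.square_hat_nonneg` of 77a).  In the notation of memo
FROM-fk-2-g36 / FK-Q2 §45: `⟨K, Φ⟩ ≥ 0` for every `Φ = f̂ĝ` is exactly what the cones `Sq+SDY` (one root) and `Sq+SDY+SDX+KL⁺` (two roots) certify.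
[cite: Grimmett2006, §1.4 eq. (1.20) (p. 15); §3.8 Thm. (3.90) (pp. 61–62)] [cite: Wagner2006, Thm. 5.8(d), §5.3]
-/

noncomputable section

namespace Summit.CriticalPhenomena.PercolationContinuityZ3.Theorems

namespace FK

open SimpleGraph Literature.Probability.LatticeModels Literature.Probability.Percolation
open scoped Classical

variable {V : Type*}

/-! ### One root: the sliced identity -/

/-- **Root-slicing identity (one root).**  For `e ∈ S ⊆ M`, `f` reading only `S`, `g` not reading `S` and `Φ = f̂ĝ`:
`Σ_{γ ⊆ M, ℓ(γ) ≤ J} Φ(γ) = −Σ_{δ ⊆ M∖e} (1{ℓ(τ_Sδ) ≤ J} − 1{ℓ(δ) ≤ J}) Φ(δ)`. [folklore] -/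
theorem levels_sum_eq_neg_rootSlice (M C S : Finset (Sym2 V)) (hS : S ⊆ M) {e : Sym2 V} (he : e ∈ S) (J : ℕ)
    (f g : Finset (Sym2 V) → ℝ)
    (hf : ∀ a : Sym2 V, a ∉ S → ∀ A : Finset (Sym2 V), f (insert a A) = f A)
    (hg : ∀ a ∈ S, ∀ A : Finset (Sym2 V), g (insert a A) = g A) :
    ∑ γ ∈ M.powerset with apExpC M C γ ≤ J, (f (γ ∪ C) - f (M \ γ ∪ C)) * (g (γ ∪ C) - g (M \ γ ∪ C)) =
      -∑ δ ∈ (M.erase e).powerset,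
        ((if apExpC M C (S \ δ ∪ δ \ S) ≤ J then (1 : ℝ) else 0) - (if apExpC M C δ ≤ J then (1 : ℝ) else 0)) *
          ((f (δ ∪ C) - f (M \ δ ∪ C)) * (g (δ ∪ C) - g (M \ δ ∪ C))) := by
  set Φ : Finset (Sym2 V) → ℝ := fun γ => (f (γ ∪ C) - f (M \ γ ∪ C)) * (g (γ ∪ C) - g (M \ γ ∪ C)) with hΦ
  have heM : e ∈ M := hS he
  have heM' : e ∉ M.erase e := Finset.notMem_erase e M
  have hS' : S.erase e ⊆ M.erase e := Finset.erase_subset_erase e hS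
  have hpow : M.powerset = (insert e (M.erase e)).powerset := by rw [Finset.insert_erase heM]
  have hsplit : ∑ γ ∈ M.powerset, (if apExpC M C γ ≤ J then Φ γ else 0) =
      ∑ δ ∈ (M.erase e).powerset, (if apExpC M C δ ≤ J then Φ δ else 0) +
        ∑ δ ∈ (M.erase e).powerset, (if apExpC M C (insert e δ) ≤ J then Φ (insert e δ) else 0) := by
    rw [hpow, Finset.sum_powerset_insert heM']
  have hflip : ∑ δ ∈ (M.erase e).powerset, (if apExpC M C (insert e δ) ≤ J then Φ (insert e δ) else 0) =
      -∑ δ ∈ (M.erase e).powerset, (if apExpC M C (S \ δ ∪ δ \ S) ≤ J then Φ δ else 0) := by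
    rw [← Finset.sum_neg_distrib]
    symm
    refine Finset.sum_nbij' (fun δ => S.erase e \ δ ∪ δ \ S.erase e) (fun δ => S.erase e \ δ ∪ δ \ S.erase e)
      (fun δ hδ => ?_) (fun δ hδ => ?_) (fun δ hδ => ?_) (fun δ hδ => ?_) (fun δ hδ => ?_)
    · exact Finset.mem_powerset.2 (sflip_subset hS' (Finset.mem_powerset.1 hδ))
    · exact Finset.mem_powerset.2 (sflip_subset hS' (Finset.mem_powerset.1 hδ))
    · exact sflip_sflip hS' (Finset.mem_powerset.1 hδ)
    · exact sflip_sflip hS' (Finset.mem_powerset.1 hδ)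
    · have hδ' : δ ⊆ M.erase e := Finset.mem_powerset.1 hδ
      obtain ⟨hδM, heδ⟩ := subset_of_subset_erase hδ'
      rw [insert_sflip_erase he heδ]
      have hval : Φ (S \ δ ∪ δ \ S) = -Φ δ := by
        simp only [hΦ]
        rw [hat_sflip_of_readOnly (C := C) hS hδM hf, hat_sflip_of_notRead (C := C) hS hδM hg]
        ring
      split_ifs <;> simp [hval]
  rw [Finset.sum_filter, hsplit, hflip, ← sub_eq_add_neg, ← Finset.sum_sub_distrib, ← Finset.sum_neg_distrib]
  refine Finset.sum_congr rfl fun δ _ => ?_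
  split_ifs <;> ring

/-! ### Two roots: the quarter identity -/

/-- **Root-slicing identity (two roots).**  For `e ∈ S ⊆ M`, `e' ∈ M ∖ S`, `f` reading only `S`, `g` not reading `S` and `Φ = f̂ĝ`:
`Σ_{γ ⊆ M, ℓ(γ) ≤ J} Φ(γ) = −2 Σ_{δ ⊆ M∖{e,e'}} (1{ℓ(τ_Sδ) ≤ J} − 1{ℓ(δ) ≤ J}) Φ(δ)`. [folklore] -/
theorem levels_sum_eq_neg_two_quarterSlice (M C S : Finset (Sym2 V)) (hS : S ⊆ M) {e e' : Sym2 V} (he : e ∈ S) (he' : e' ∈ M \ S)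
    (J : ℕ) (f g : Finset (Sym2 V) → ℝ)
    (hf : ∀ a : Sym2 V, a ∉ S → ∀ A : Finset (Sym2 V), f (insert a A) = f A)
    (hg : ∀ a ∈ S, ∀ A : Finset (Sym2 V), g (insert a A) = g A) :
    ∑ γ ∈ M.powerset with apExpC M C γ ≤ J, (f (γ ∪ C) - f (M \ γ ∪ C)) * (g (γ ∪ C) - g (M \ γ ∪ C)) =
      -2 * ∑ δ ∈ ((M.erase e).erase e').powerset,
        ((if apExpC M C (S \ δ ∪ δ \ S) ≤ J then (1 : ℝ) else 0) - (if apExpC M C δ ≤ J then (1 : ℝ) else 0)) *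
          ((f (δ ∪ C) - f (M \ δ ∪ C)) * (g (δ ∪ C) - g (M \ δ ∪ C))) := by
  set Φ : Finset (Sym2 V) → ℝ := fun γ => (f (γ ∪ C) - f (M \ γ ∪ C)) * (g (γ ∪ C) - g (M \ γ ∪ C)) with hΦ
  have heM : e ∈ M := hS he
  have he'M : e' ∈ M := (Finset.mem_sdiff.1 he').1
  have he'S : e' ∉ S := (Finset.mem_sdiff.1 he').2
  have hee' : e' ≠ e := fun h => he'S (h ▸ he)
  have heM' : e ∉ M.erase e := Finset.notMem_erase e M
  have he'Me : e' ∈ M.erase e := Finset.mem_erase.2 ⟨hee', he'M⟩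
  have he'M'' : e' ∉ (M.erase e).erase e' := Finset.notMem_erase e' _
  have hS' : S.erase e ⊆ (M.erase e).erase e' := by
    intro x hx
    have hxS : x ∈ S := Finset.mem_of_mem_erase hx
    exact Finset.mem_erase.2 ⟨fun h => he'S (h ▸ hxS), Finset.mem_erase.2 ⟨(Finset.mem_erase.1 hx).1, hS hxS⟩⟩
  have hN' : (M \ S).erase e' ⊆ (M.erase e).erase e' := by
    intro x hx
    have hxN : x ∈ M \ S := Finset.mem_of_mem_erase hx
    exact Finset.mem_erase.2 ⟨(Finset.mem_erase.1 hx).1,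
      Finset.mem_erase.2 ⟨fun h => (Finset.mem_sdiff.1 hxN).2 (h ▸ he), (Finset.mem_sdiff.1 hxN).1⟩⟩
  have hsub : ∀ δ ∈ ((M.erase e).erase e').powerset, δ ⊆ M ∧ e ∉ δ ∧ e' ∉ δ := by
    intro δ hδ
    have h0 : δ ⊆ (M.erase e).erase e' := Finset.mem_powerset.1 hδ
    have h1 : δ ⊆ M.erase e := h0.trans (Finset.erase_subset _ _)
    exact ⟨h1.trans (Finset.erase_subset _ _), fun h => heM' (h1 h), fun h => he'M'' (h0 h)⟩
  have hslice_e : ∑ δ ∈ ((M.erase e).erase e').powerset, (if apExpC M C (insert e δ) ≤ J then Φ (insert e δ) else 0) =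
      -∑ δ ∈ ((M.erase e).erase e').powerset, (if apExpC M C (S \ δ ∪ δ \ S) ≤ J then Φ δ else 0) := by
    rw [← Finset.sum_neg_distrib]
    symm
    refine Finset.sum_nbij' (fun δ => S.erase e \ δ ∪ δ \ S.erase e) (fun δ => S.erase e \ δ ∪ δ \ S.erase e)
      (fun δ hδ => ?_) (fun δ hδ => ?_) (fun δ hδ => ?_) (fun δ hδ => ?_) (fun δ hδ => ?_)
    · exact Finset.mem_powerset.2 (sflip_subset hS' (Finset.mem_powerset.1 hδ))
    · exact Finset.mem_powerset.2 (sflip_subset hS' (Finset.mem_powerset.1 hδ))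
    · exact sflip_sflip hS' (Finset.mem_powerset.1 hδ)
    · exact sflip_sflip hS' (Finset.mem_powerset.1 hδ)
    · obtain ⟨hδM, heδ, -⟩ := hsub δ hδ
      rw [insert_sflip_erase he heδ]
      have hval : Φ (S \ δ ∪ δ \ S) = -Φ δ := by
        simp only [hΦ]
        rw [hat_sflip_of_readOnly (C := C) hS hδM hf, hat_sflip_of_notRead (C := C) hS hδM hg]
        ring
      split_ifs <;> simp [hval]
  have hslice_e' : ∑ δ ∈ ((M.erase e).erase e').powerset, (if apExpC M C (insert e' δ) ≤ J then Φ (insert e' δ) else 0) =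
      -∑ δ ∈ ((M.erase e).erase e').powerset, (if apExpC M C (S \ δ ∪ δ \ S) ≤ J then Φ δ else 0) := by
    rw [← Finset.sum_neg_distrib]
    symm
    refine Finset.sum_nbij' (fun δ => (M \ S).erase e' \ δ ∪ δ \ (M \ S).erase e')
      (fun δ => (M \ S).erase e' \ δ ∪ δ \ (M \ S).erase e')
      (fun δ hδ => ?_) (fun δ hδ => ?_) (fun δ hδ => ?_) (fun δ hδ => ?_) (fun δ hδ => ?_)
    · exact Finset.mem_powerset.2 (sflip_subset hN' (Finset.mem_powerset.1 hδ))
    · exact Finset.mem_powerset.2 (sflip_subset hN' (Finset.mem_powerset.1 hδ))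
    · exact sflip_sflip hN' (Finset.mem_powerset.1 hδ)
    · exact sflip_sflip hN' (Finset.mem_powerset.1 hδ)
    · obtain ⟨hδM, -, he'δ⟩ := hsub δ hδ
      rw [insert_sflip_erase he' he'δ]
      have hval : Φ ((M \ S) \ δ ∪ δ \ (M \ S)) = -Φ δ := by
        simp only [hΦ]
        rw [hat_nflip_of_readOnly (C := C) hS hδM hf, hat_nflip_of_notRead (C := C) hS hδM hg]
        ring
      simp only [apExpC_nflip M C S δ hS hδM]
      split_ifs <;> simp [hval]
  have hslice_ee' : ∑ δ ∈ ((M.erase e).erase e').powerset,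
      (if apExpC M C (insert e (insert e' δ)) ≤ J then Φ (insert e (insert e' δ)) else 0) =
      ∑ δ ∈ ((M.erase e).erase e').powerset, (if apExpC M C δ ≤ J then Φ δ else 0) := by
    symm
    refine Finset.sum_nbij' (fun δ => ((M.erase e).erase e') \ δ) (fun δ => ((M.erase e).erase e') \ δ)
      (fun δ hδ => ?_) (fun δ hδ => ?_) (fun δ hδ => ?_) (fun δ hδ => ?_) (fun δ hδ => ?_)
    · exact Finset.mem_powerset.2 Finset.sdiff_subset
    · exact Finset.mem_powerset.2 Finset.sdiff_subset
    · exact Finset.sdiff_sdiff_eq_self (Finset.mem_powerset.1 hδ)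
    · exact Finset.sdiff_sdiff_eq_self (Finset.mem_powerset.1 hδ)
    · obtain ⟨hδM, -, -⟩ := hsub δ hδ
      rw [insert_insert_sdiff_eq heM he'M (Finset.mem_powerset.1 hδ)]
      have hval : Φ (M \ δ) = Φ δ := by simp only [hΦ]; exact hat_prod_sdiff M C f g hδM
      simp only [apExpC_sdiff M C hδM, hval]
  have hpow1 : M.powerset = (insert e (M.erase e)).powerset := by rw [Finset.insert_erase heM]
  have hpow2 : (M.erase e).powerset = (insert e' ((M.erase e).erase e')).powerset := by rw [Finset.insert_erase he'Me]
  rw [Finset.sum_filter, hpow1, Finset.sum_powerset_insert heM', hpow2, Finset.sum_powerset_insert he'M'',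
    Finset.sum_powerset_insert he'M'', hslice_e, hslice_e', hslice_ee']
  have hexp : ∑ δ ∈ ((M.erase e).erase e').powerset,
      ((if apExpC M C (S \ δ ∪ δ \ S) ≤ J then (1 : ℝ) else 0) - (if apExpC M C δ ≤ J then (1 : ℝ) else 0)) * Φ δ =
      ∑ δ ∈ ((M.erase e).erase e').powerset, (if apExpC M C (S \ δ ∪ δ \ S) ≤ J then Φ δ else 0) -
        ∑ δ ∈ ((M.erase e).erase e').powerset, (if apExpC M C δ ≤ J then Φ δ else 0) := by
    rw [← Finset.sum_sub_distrib]
    refine Finset.sum_congr rfl fun δ _ => ?_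
    split_ifs <;> ring
  rw [hexp]
  ring

/-! ### Positivity of `f̂ĝ` on the folded generators (two roots) -/

section Generators

variable (M C S : Finset (Sym2 V)) (f g : Finset (Sym2 V) → ℝ)

/-- **`S`-symmetrised down-move in `N` is nonnegative on `f̂ĝ`** (`e ∈ S` root, `n ∈ M∖S`, `δ ⊆ M∖e`): it equals the `(e,n)`-square.
[cite: Grimmett2006, §3.8 Thm. (3.90) (pp. 61–62)] -/
theorem symDownY_hat_nonneg (hS : S ⊆ M) {e : Sym2 V} (he : e ∈ S) {n : Sym2 V} (hn : n ∈ M \ S)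
    (hf : ∀ a : Sym2 V, a ∉ S → ∀ A : Finset (Sym2 V), f (insert a A) = f A)
    (hg : ∀ a ∈ S, ∀ A : Finset (Sym2 V), g (insert a A) = g A)
    (hfm : ∀ ⦃A B : Finset (Sym2 V)⦄, A ⊆ B → f A ≤ f B) (hgm : ∀ ⦃A B : Finset (Sym2 V)⦄, A ⊆ B → g A ≤ g B)
    {δ : Finset (Sym2 V)} (hδ : δ ⊆ M.erase e) :
    let Φ : Finset (Sym2 V) → ℝ := fun γ => (f (γ ∪ C) - f (M \ γ ∪ C)) * (g (γ ∪ C) - g (M \ γ ∪ C))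
    0 ≤ Φ δ + Φ (S.erase e \ δ ∪ δ \ S.erase e) - Φ (insert n δ) - Φ (insert n (S.erase e \ δ ∪ δ \ S.erase e)) := by
  intro Φ
  have hnS : n ∉ S := (Finset.mem_sdiff.1 hn).2
  have hne : n ≠ e := fun h => hnS (h ▸ he)
  have hnS' : n ∉ S.erase e := fun h => hnS (Finset.mem_of_mem_erase h)
  have hnδ : insert n δ ⊆ M.erase e := Finset.insert_subset (Finset.mem_erase.2 ⟨hne, (Finset.mem_sdiff.1 hn).1⟩) hδ
  have eq1 : Φ (S.erase e \ δ ∪ δ \ S.erase e) = -Φ (insert e δ) := hat_prod_sflip_erase M C S f g hS he hf hg hδ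
  have eq2 : Φ (insert n (S.erase e \ δ ∪ δ \ S.erase e)) = -Φ (insert e (insert n δ)) := by
    rw [insert_tflip_of_notMem hnS']; exact hat_prod_sflip_erase M C S f g hS he hf hg hnδ
  rw [eq1, eq2]
  have := square_hat_nonneg M C S f g he hnS hf hg hfm hgm δ
  simp only [Φ] at this ⊢
  linarith

/-- **`N`-symmetrised down-move in `S` is nonnegative on `f̂ĝ`** (`e' ∈ M∖S` root, `a ∈ S`, `δ ⊆ M∖e'`): it equals the `(a,e')`-square.
[cite: Grimmett2006, §3.8 Thm. (3.90) (pp. 61–62)] -/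
theorem symDownX_hat_nonneg (hS : S ⊆ M) {e' : Sym2 V} (he' : e' ∈ M \ S) {a : Sym2 V} (ha : a ∈ S)
    (hf : ∀ b : Sym2 V, b ∉ S → ∀ A : Finset (Sym2 V), f (insert b A) = f A)
    (hg : ∀ b ∈ S, ∀ A : Finset (Sym2 V), g (insert b A) = g A)
    (hfm : ∀ ⦃A B : Finset (Sym2 V)⦄, A ⊆ B → f A ≤ f B) (hgm : ∀ ⦃A B : Finset (Sym2 V)⦄, A ⊆ B → g A ≤ g B)
    {δ : Finset (Sym2 V)} (hδ : δ ⊆ M.erase e') :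
    let Φ : Finset (Sym2 V) → ℝ := fun γ => (f (γ ∪ C) - f (M \ γ ∪ C)) * (g (γ ∪ C) - g (M \ γ ∪ C))
    0 ≤ Φ δ + Φ ((M \ S).erase e' \ δ ∪ δ \ (M \ S).erase e') - Φ (insert a δ) -
      Φ (insert a ((M \ S).erase e' \ δ ∪ δ \ (M \ S).erase e')) := by
  intro Φ
  have he'S : e' ∉ S := (Finset.mem_sdiff.1 he').2
  have hae' : a ≠ e' := fun h => he'S (h ▸ ha)
  have haN' : a ∉ (M \ S).erase e' := fun h => (Finset.mem_sdiff.1 (Finset.mem_of_mem_erase h)).2 ha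
  have haδ : insert a δ ⊆ M.erase e' := Finset.insert_subset (Finset.mem_erase.2 ⟨hae', hS ha⟩) hδ
  have eq1 : Φ ((M \ S).erase e' \ δ ∪ δ \ (M \ S).erase e') = -Φ (insert e' δ) := hat_prod_nflip_erase M C S f g hS he' hf hg hδ
  have eq2 : Φ (insert a ((M \ S).erase e' \ δ ∪ δ \ (M \ S).erase e')) = -Φ (insert e' (insert a δ)) := by
    rw [insert_tflip_of_notMem haN']; exact hat_prod_nflip_erase M C S f g hS he' hf hg haδ
  rw [eq1, eq2, Finset.insert_comm e' a δ]
  have := square_hat_nonneg M C S f g ha he'S hf hg hfm hgm δ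
  simp only [Φ] at this ⊢
  linarith

/-- **The Klein orbit is nonnegative on `f̂ĝ`** (`e ∈ S`, `e' ∈ M∖S`, `δ ⊆ M∖{e,e'}`): `Φ(δ)+Φ(τ'δ)+Φ(σ'δ)+Φ(M''∖δ)` equals the `(e,e')`-square.
[cite: Grimmett2006, §3.8 Thm. (3.90) (pp. 61–62)] -/
theorem kleinOrbit_hat_nonneg (hS : S ⊆ M) {e e' : Sym2 V} (he : e ∈ S) (he' : e' ∈ M \ S)
    (hf : ∀ a : Sym2 V, a ∉ S → ∀ A : Finset (Sym2 V), f (insert a A) = f A)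
    (hg : ∀ a ∈ S, ∀ A : Finset (Sym2 V), g (insert a A) = g A)
    (hfm : ∀ ⦃A B : Finset (Sym2 V)⦄, A ⊆ B → f A ≤ f B) (hgm : ∀ ⦃A B : Finset (Sym2 V)⦄, A ⊆ B → g A ≤ g B)
    {δ : Finset (Sym2 V)} (hδ : δ ⊆ (M.erase e).erase e') :
    let Φ : Finset (Sym2 V) → ℝ := fun γ => (f (γ ∪ C) - f (M \ γ ∪ C)) * (g (γ ∪ C) - g (M \ γ ∪ C))
    0 ≤ Φ δ + Φ (S.erase e \ δ ∪ δ \ S.erase e) + Φ ((M \ S).erase e' \ δ ∪ δ \ (M \ S).erase e') +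
      Φ (((M.erase e).erase e') \ δ) := by
  intro Φ
  have heM : e ∈ M := hS he
  have he'M : e' ∈ M := (Finset.mem_sdiff.1 he').1
  have he'S : e' ∉ S := (Finset.mem_sdiff.1 he').2
  have hδe : δ ⊆ M.erase e := hδ.trans (Finset.erase_subset _ _)
  have hδe' : δ ⊆ M.erase e' := by
    intro x hx
    have := hδ hx
    exact Finset.mem_erase.2 ⟨(Finset.mem_erase.1 this).1, Finset.mem_of_mem_erase (Finset.mem_erase.1 this).2⟩
  have hδM : δ ⊆ M := hδe.trans (Finset.erase_subset _ _)
  have eq1 : Φ (S.erase e \ δ ∪ δ \ S.erase e) = -Φ (insert e δ) := hat_prod_sflip_erase M C S f g hS he hf hg hδe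
  have eq2 : Φ ((M \ S).erase e' \ δ ∪ δ \ (M \ S).erase e') = -Φ (insert e' δ) := hat_prod_nflip_erase M C S f g hS he' hf hg hδe'
  have hγ : insert e (insert e' δ) ⊆ M := Finset.insert_subset heM (Finset.insert_subset he'M hδM)
  have eq3 : Φ (((M.erase e).erase e') \ δ) = Φ (insert e (insert e' δ)) := by
    rw [← sdiff_insert_insert_eq]; exact hat_prod_sdiff M C f g hγ
  rw [eq1, eq2, eq3]
  have := square_hat_nonneg M C S f g he he'S hf hg hfm hgm δ
  simp only [Φ] at this ⊢
  linarith

end Generators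

end FK

end Summit.CriticalPhenomena.PercolationContinuityZ3.Theorems

end
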